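import Summits.HodgeConjecture.CorCM.IrreducibleOddWeightsMultiClassDefect
import HarnessLib

/-!
# The multiplicity formula across all isotypic classes, IX: THE MULTI-CLASS COMMUTANT CERTIFICATE — one component
# per class and slot: `dim(MC₀ ∩ MC₁) = Σ_{c : b¹_c ≠ 0, b¹_c ∈ D_c·b⁰_c} dim A_c`,
# `rank Φ₀ + rank Φ₁ = rank(Φ₀,Φ₁) + 1 + Σ_c [b¹_c ≠ 0 ∧ b¹_c ∈ D_c·b⁰_c]·dim A_c`, `rank(Φ₀,Φ₁) = rank Φ₀ ⟺ ∀ c, b¹_c ∈ D_c·b⁰_c`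

COR-CM (cell `pub-hodgecm2`, binder seat `b16` gen 75, count-neutral claim THE MULTIPLICITY FORMULA ACROSS ALL
ISOTYPIC CLASSES FOR A WHOLE FAMILY, file M9 — abstract `G`-set level and type ranks; theorems only, no definition,
no named fact, no `sorry`).  NEW as stated, hence under `Summits/`.  HONEST FRAMING: linear algebra of translates of
functions on finite `G`-sets (files M1–M8, gen 72 C4/C6); nothing about Hodge classes is asserted, `HC_CM` is neither
used nor asserted.  Gen 72 C4's certificate (ONE class, one component per side: `dim A` if `b′ ∈ D·b`, else `0`)
summed over all classes — the census-facing form of files M6/M8 (multiplicity ≤ 1 per class and slot).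

SETTING.  Pairwise non-isomorphic reference irreducibles `A_c ≤ ℚ^{Y_c}` (`A_c ≠ 0`, commutant `𝒟_c` ANY); two slots
`Y₀`, `Y₁`; per class ONE equivariant map `ι⁰_c : ℚ^{Y_c} → ℚ^{Y₀}`, `ι¹_c : ℚ^{Y_c} → ℚ^{Y₁}` injective on `A_c`, and
components `b⁰_c, b¹_c ∈ A_c` (ZERO allowed: a class absent from a slot); `W = Σ_c ι⁰_c(b⁰_c)`, `W′ = Σ_c ι¹_c(b¹_c)`;
D-lines `D_c·b = 𝒟_c.map (applyₗ b)`.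

* §1 general components: `dim(S(W) ∩ S(W′)) = Σ_c dim(S(p_c) ∩ S(p′_c)) = Σ_c m_c·dim A_c` (`dim(D_c⟨b_c⟩ ∩ D_c⟨b′_c⟩)
  = m_c·δ_c`); §3 `rank Φ₀ + rank Φ₁ = rank(Φ₀,Φ₁) + 1 + Σ_c m_c·dim A_c`.
* §2 one component per class and slot: **`dim(S(W) ∩ S(W′)) = Σ_c (dim A_c if b¹_c ≠ 0 ∧ b¹_c ∈ D_c·b⁰_c, else 0)`**,
  **`S(W′) ≤ S(W) ⟺ ∀ c, b¹_c ∈ D_c·b⁰_c`**; §3 **`rank Φ₀ + rank Φ₁ = rank(Φ₀,Φ₁) + 1 + Σ_c [b¹_c ≠ 0 ∧ b¹_c ∈ D_c·b⁰_c]·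
  dim A_c`**, **`rank(Φ₀,Φ₁) = rank Φ₀ ⟺ ∀ c, b¹_c ∈ D_c·b⁰_c`**; CM dress.

## References

* [Lang2002] S. Lang, *Algebra*, 3rd ed., XVII §1–§3.
* [CurtisReiner1962] C. W. Curtis, I. Reiner, *Representation Theory of Finite Groups and Associative Algebras*, §27.
* [Gordon1999HodgeAVSurvey] B. B. Gordon, *A survey of the Hodge conjecture for abelian varieties*, §3, 7.5–7.7, 9.4.3.
* [Deligne1982HodgeCycles] P. Deligne, *Hodge cycles on abelian varieties*, LNM 900 (1982), I.5 (p. 53).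
-/

set_option autoImplicit false

noncomputable section
open scoped BigOperators Classical

universe u uC uJ uJ' v v' v'' vC w

namespace Summit.HodgeConjecture.CorCM.IrrOdd

open Literature.NumberTheory.ComplexMultiplication

variable {G : Type w} [Group G]
  {C : Type uC} [Fintype C] {Yc : C → Type vC} [∀ c, MulAction G (Yc c)] [∀ c, Fintype (Yc c)]
  {Ar : ∀ c, Submodule ℚ (Yc c → ℚ)} {𝒟 : ∀ c, Submodule ℚ ((Yc c → ℚ) →ₗ[ℚ] (Yc c → ℚ))}

/-! ### §1 Two slots, general components -/

section TwoSlots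

variable {Y₀ : Type v'} [MulAction G Y₀] [Fintype Y₀] {Y₁ : Type v''} [MulAction G Y₁] [Fintype Y₁]
  {J₀ : C → Type uJ} [∀ c, Fintype (J₀ c)] {J₁ : C → Type uJ'} [∀ c, Fintype (J₁ c)]

/-- **TWO SLOTS: `dim(S(W) ∩ S(W′)) = Σ_c dim(S(p_c) ∩ S(p′_c))`** — the defect is the sum of the class defects (gen 70
I11 in the reference-irreducible currency). [cite: Gordon1999HodgeAVSurvey, §3 Theorem (proof), 7.5–7.7] -/
theorem finrank_span_shadowCoeff_inf_eq_sum_of_classes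
    (hRst : ∀ c (k : G) (a : Yc c → ℚ), a ∈ Ar c → (fun y => a (k • y)) ∈ Ar c)
    (hRirr : ∀ c (W : Submodule ℚ (Yc c → ℚ)), W ≤ Ar c → W ≠ ⊥ →
      (∀ (k : G) (f : Yc c → ℚ), f ∈ W → (fun y => f (k • y)) ∈ W) → W = Ar c)
    (hsep : ∀ c c' (L : (Yc c → ℚ) →ₗ[ℚ] (Yc c' → ℚ)), c ≠ c' → Ar c ≠ ⊥ → (∀ a ∈ Ar c, L a ∈ Ar c') →
      (∀ a ∈ Ar c, L a = 0 → a = 0) →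
      (∀ (k : G) (a : Yc c → ℚ), a ∈ Ar c → L (fun y => a (k • y)) = fun y => L a (k • y)) → False)
    (ι₀ : ∀ c, J₀ c → ((Yc c → ℚ) →ₗ[ℚ] (Y₀ → ℚ))) (ι₁ : ∀ c, J₁ c → ((Yc c → ℚ) →ₗ[ℚ] (Y₁ → ℚ)))
    (hι₀eq : ∀ c (j : J₀ c) (k : G) (a : Yc c → ℚ), a ∈ Ar c →
      ι₀ c j (fun y => a (k • y)) = fun y => ι₀ c j a (k • y))
    (hι₁eq : ∀ c (j : J₁ c) (k : G) (a : Yc c → ℚ), a ∈ Ar c →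
      ι₁ c j (fun y => a (k • y)) = fun y => ι₁ c j a (k • y))
    (hind₀ : ∀ c (f : J₀ c → (Yc c → ℚ)), (∀ j, f j ∈ Ar c) → ∑ j, ι₀ c j (f j) = 0 → ∀ j, f j = 0)
    (hind₁ : ∀ c (f : J₁ c → (Yc c → ℚ)), (∀ j, f j ∈ Ar c) → ∑ j, ι₁ c j (f j) = 0 → ∀ j, f j = 0)
    {b₀ : ∀ c, J₀ c → (Yc c → ℚ)} {b₁ : ∀ c, J₁ c → (Yc c → ℚ)}
    (hb₀ : ∀ c j, b₀ c j ∈ Ar c) (hb₁ : ∀ c j, b₁ c j ∈ Ar c) :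
    Module.finrank ℚ
        ↥(Submodule.span ℚ (Set.range fun y : Y₀ => fun g : G => (∑ c, ∑ j, ι₀ c j (b₀ c j)) (g • y)) ⊓
          Submodule.span ℚ (Set.range fun y : Y₁ => fun g : G => (∑ c, ∑ j, ι₁ c j (b₁ c j)) (g • y))) =
      ∑ c, Module.finrank ℚ
        ↥(Submodule.span ℚ (Set.range fun y : Y₀ => fun g : G => (∑ j, ι₀ c j (b₀ c j)) (g • y)) ⊓
          Submodule.span ℚ (Set.range fun y : Y₁ => fun g : G => (∑ j, ι₁ c j (b₁ c j)) (g • y))) := by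
  haveI : ∀ c, Module.Finite ℚ
      ↥(Submodule.span ℚ (Set.range fun y : Y₀ => fun g : G => (∑ j, ι₀ c j (b₀ c j)) (g • y))) := fun c =>
    Module.Finite.span_of_finite ℚ (Set.finite_range _)
  rw [span_shadowCoeff_sum_classes_eq_iSup hRst hRirr hsep ι₀ hι₀eq hind₀ hb₀,
    span_shadowCoeff_sum_classes_eq_iSup hRst hRirr hsep ι₁ hι₁eq hind₁ hb₁]
  exact finrank_iSup_inf_iSup_eq_sum_of_iSupIndep (iSupIndep_container_of_classes hRst hRirr hsep)
    (fun c => span_shadowCoeff_sum_le_container (ι₀ c) (hι₀eq c) (hb₀ c))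
    fun c => span_shadowCoeff_sum_le_container (ι₁ c) (hι₁eq c) (hb₁ c)

/-- **TWO SLOTS OVER THE COMMUTANTS**: `∃ m_c`, `dim(D_c⟨b_c⟩ ∩ D_c⟨b′_c⟩) = m_c·δ_c`, **`dim(S(W) ∩ S(W′)) = Σ_c m_c·dim
A_c`** (C4 class by class). [cite: Lang2002, XVII §3] [cite: Gordon1999HodgeAVSurvey, §3 Theorem (proof), 7.5–7.7] -/
theorem exists_finrank_span_shadowCoeff_inf_eq_sum_mul_of_classes
    (h𝒟 : ∀ c (L : (Yc c → ℚ) →ₗ[ℚ] (Yc c → ℚ)), L ∈ 𝒟 c ↔ (∀ a ∈ Ar c, L a ∈ Ar c) ∧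
      ∀ (k : G) (a : Yc c → ℚ), a ∈ Ar c → L (fun y => a (k • y)) = fun y => L a (k • y))
    (hRst : ∀ c (k : G) (a : Yc c → ℚ), a ∈ Ar c → (fun y => a (k • y)) ∈ Ar c)
    (hRirr : ∀ c (W : Submodule ℚ (Yc c → ℚ)), W ≤ Ar c → W ≠ ⊥ →
      (∀ (k : G) (f : Yc c → ℚ), f ∈ W → (fun y => f (k • y)) ∈ W) → W = Ar c)
    (hsep : ∀ c c' (L : (Yc c → ℚ) →ₗ[ℚ] (Yc c' → ℚ)), c ≠ c' → Ar c ≠ ⊥ → (∀ a ∈ Ar c, L a ∈ Ar c') →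
      (∀ a ∈ Ar c, L a = 0 → a = 0) →
      (∀ (k : G) (a : Yc c → ℚ), a ∈ Ar c → L (fun y => a (k • y)) = fun y => L a (k • y)) → False)
    (ι₀ : ∀ c, J₀ c → ((Yc c → ℚ) →ₗ[ℚ] (Y₀ → ℚ))) (ι₁ : ∀ c, J₁ c → ((Yc c → ℚ) →ₗ[ℚ] (Y₁ → ℚ)))
    (hι₀eq : ∀ c (j : J₀ c) (k : G) (a : Yc c → ℚ), a ∈ Ar c →
      ι₀ c j (fun y => a (k • y)) = fun y => ι₀ c j a (k • y))
    (hι₁eq : ∀ c (j : J₁ c) (k : G) (a : Yc c → ℚ), a ∈ Ar c →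
      ι₁ c j (fun y => a (k • y)) = fun y => ι₁ c j a (k • y))
    (hind₀ : ∀ c (f : J₀ c → (Yc c → ℚ)), (∀ j, f j ∈ Ar c) → ∑ j, ι₀ c j (f j) = 0 → ∀ j, f j = 0)
    (hind₁ : ∀ c (f : J₁ c → (Yc c → ℚ)), (∀ j, f j ∈ Ar c) → ∑ j, ι₁ c j (f j) = 0 → ∀ j, f j = 0)
    {b₀ : ∀ c, J₀ c → (Yc c → ℚ)} {b₁ : ∀ c, J₁ c → (Yc c → ℚ)}
    (hb₀ : ∀ c j, b₀ c j ∈ Ar c) (hb₁ : ∀ c j, b₁ c j ∈ Ar c)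
    {a₀ : ∀ c, Yc c → ℚ} (ha₀ : ∀ c, a₀ c ∈ Ar c) (h0 : ∀ c, a₀ c ≠ 0) :
    ∃ m : C → ℕ,
      (∀ c, Module.finrank ℚ ↥((⨆ j, (𝒟 c).map (LinearMap.applyₗ (b₀ c j))) ⊓
          ⨆ j, (𝒟 c).map (LinearMap.applyₗ (b₁ c j))) = m c * Module.finrank ℚ ↥((𝒟 c).map (LinearMap.applyₗ (a₀ c)))) ∧
      Module.finrank ℚ
          ↥(Submodule.span ℚ (Set.range fun y : Y₀ => fun g : G => (∑ c, ∑ j, ι₀ c j (b₀ c j)) (g • y)) ⊓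
            Submodule.span ℚ (Set.range fun y : Y₁ => fun g : G => (∑ c, ∑ j, ι₁ c j (b₁ c j)) (g • y))) =
        ∑ c, m c * Module.finrank ℚ (Ar c) := by
  choose m hD hS using fun c => exists_finrank_span_shadowCoeff_inf_eq_mul (h𝒟 c) (hRst c) (hRirr c) (ι₀ c) (ι₁ c)
    (hι₀eq c) (hι₁eq c) (hind₀ c) (hind₁ c) (hb₀ c) (hb₁ c) (ha₀ c) (h0 c)
  refine ⟨m, hD, ?_⟩
  rw [finrank_span_shadowCoeff_inf_eq_sum_of_classes hRst hRirr hsep ι₀ ι₁ hι₀eq hι₁eq hind₀ hind₁ hb₀ hb₁]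
  exact Finset.sum_congr rfl fun c _ => hS c

end TwoSlots

/-! ### §2 One component per class and slot -/

section Single

variable {Y₀ : Type v'} [MulAction G Y₀] [Fintype Y₀] {Y₁ : Type v''} [MulAction G Y₁] [Fintype Y₁]

/-- One slot, one component per class: `S(Σ_c ι_c(b_c)) = ⨆_c S(ι_c(b_c))` (file M1). [cite: Lang2002, XVII §2] -/
theorem span_shadowCoeff_sum_single_eq_iSup_of_classes
    (hRst : ∀ c (k : G) (a : Yc c → ℚ), a ∈ Ar c → (fun y => a (k • y)) ∈ Ar c)
    (hRirr : ∀ c (W : Submodule ℚ (Yc c → ℚ)), W ≤ Ar c → W ≠ ⊥ →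
      (∀ (k : G) (f : Yc c → ℚ), f ∈ W → (fun y => f (k • y)) ∈ W) → W = Ar c)
    (hsep : ∀ c c' (L : (Yc c → ℚ) →ₗ[ℚ] (Yc c' → ℚ)), c ≠ c' → Ar c ≠ ⊥ → (∀ a ∈ Ar c, L a ∈ Ar c') →
      (∀ a ∈ Ar c, L a = 0 → a = 0) →
      (∀ (k : G) (a : Yc c → ℚ), a ∈ Ar c → L (fun y => a (k • y)) = fun y => L a (k • y)) → False)
    (ι₀ : ∀ c, (Yc c → ℚ) →ₗ[ℚ] (Y₀ → ℚ))
    (hι₀eq : ∀ c (k : G) (a : Yc c → ℚ), a ∈ Ar c → ι₀ c (fun y => a (k • y)) = fun y => ι₀ c a (k • y))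
    (hinj₀ : ∀ c, ∀ f ∈ Ar c, ι₀ c f = 0 → f = 0) {b₀ : ∀ c, Yc c → ℚ} (hb₀ : ∀ c, b₀ c ∈ Ar c) :
    Submodule.span ℚ (Set.range fun y : Y₀ => fun g : G => (∑ c, ι₀ c (b₀ c)) (g • y)) =
      ⨆ c, Submodule.span ℚ (Set.range fun y : Y₀ => fun g : G => ι₀ c (b₀ c) (g • y)) := by
  have hP := iSupIndep_iSup_map_of_classes (JJ := fun _ => Unit) hRst hRirr hsep (fun c _ => ι₀ c)
    (fun c _ k a ha => hι₀eq c k a ha)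
    (fun c f hf hf0 j => hinj₀ c _ (hf j) (by
      rw [← hf0]
      exact (Fintype.sum_unique fun j => ι₀ c (f j)).symm.trans (by cases j; rfl)))
  simp only [iSup_const] at hP
  exact span_shadowCoeff_sum_eq_iSup_of_iSupIndep (P := fun c => (Ar c).map (ι₀ c))
    (fun c k v hv => by
      obtain ⟨a, ha, rfl⟩ := hv
      exact ⟨fun y => a (k • y), hRst c k a ha, hι₀eq c k a ha⟩)
    hP fun c => ⟨b₀ c, hb₀ c, rfl⟩

/-- **THE MULTI-CLASS COMMUTANT CERTIFICATE: `dim(S(W) ∩ S(W′)) = Σ_c (dim A_c if b¹_c ≠ 0 ∧ b¹_c ∈ D_c·b⁰_c, else 0)`**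
(one component per class and slot, zero allowed): a class contributes `dim A_c` exactly when both components are
non-zero on ONE D-line (C4 class by class; `b¹_c ∈ D_c·b⁰_c`, `b¹_c ≠ 0` forces `b⁰_c ≠ 0`). [cite: Lang2002, XVII §3]
[cite: CurtisReiner1962, §27 (27.3)] [cite: Gordon1999HodgeAVSurvey, §3 Theorem (proof), 7.5–7.7] -/
theorem finrank_span_shadowCoeff_inf_eq_sum_ite_of_classes
    (h𝒟 : ∀ c (L : (Yc c → ℚ) →ₗ[ℚ] (Yc c → ℚ)), L ∈ 𝒟 c ↔ (∀ a ∈ Ar c, L a ∈ Ar c) ∧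
      ∀ (k : G) (a : Yc c → ℚ), a ∈ Ar c → L (fun y => a (k • y)) = fun y => L a (k • y))
    (hRst : ∀ c (k : G) (a : Yc c → ℚ), a ∈ Ar c → (fun y => a (k • y)) ∈ Ar c)
    (hRirr : ∀ c (W : Submodule ℚ (Yc c → ℚ)), W ≤ Ar c → W ≠ ⊥ →
      (∀ (k : G) (f : Yc c → ℚ), f ∈ W → (fun y => f (k • y)) ∈ W) → W = Ar c)
    (hsep : ∀ c c' (L : (Yc c → ℚ) →ₗ[ℚ] (Yc c' → ℚ)), c ≠ c' → Ar c ≠ ⊥ → (∀ a ∈ Ar c, L a ∈ Ar c') →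
      (∀ a ∈ Ar c, L a = 0 → a = 0) →
      (∀ (k : G) (a : Yc c → ℚ), a ∈ Ar c → L (fun y => a (k • y)) = fun y => L a (k • y)) → False)
    (ι₀ : ∀ c, (Yc c → ℚ) →ₗ[ℚ] (Y₀ → ℚ)) (ι₁ : ∀ c, (Yc c → ℚ) →ₗ[ℚ] (Y₁ → ℚ))
    (hι₀eq : ∀ c (k : G) (a : Yc c → ℚ), a ∈ Ar c → ι₀ c (fun y => a (k • y)) = fun y => ι₀ c a (k • y))
    (hι₁eq : ∀ c (k : G) (a : Yc c → ℚ), a ∈ Ar c → ι₁ c (fun y => a (k • y)) = fun y => ι₁ c a (k • y))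
    (hinj₀ : ∀ c, ∀ f ∈ Ar c, ι₀ c f = 0 → f = 0) (hinj₁ : ∀ c, ∀ f ∈ Ar c, ι₁ c f = 0 → f = 0)
    {b₀ b₁ : ∀ c, Yc c → ℚ} (hb₀ : ∀ c, b₀ c ∈ Ar c) (hb₁ : ∀ c, b₁ c ∈ Ar c) :
    Module.finrank ℚ ↥(Submodule.span ℚ (Set.range fun y : Y₀ => fun g : G => (∑ c, ι₀ c (b₀ c)) (g • y)) ⊓
        Submodule.span ℚ (Set.range fun y : Y₁ => fun g : G => (∑ c, ι₁ c (b₁ c)) (g • y))) =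
      ∑ c, if b₁ c ≠ 0 ∧ b₁ c ∈ (𝒟 c).map (LinearMap.applyₗ (b₀ c)) then Module.finrank ℚ (Ar c) else 0 := by
  haveI : ∀ c, Module.Finite ℚ ↥(Submodule.span ℚ (Set.range fun y : Y₀ => fun g : G => ι₀ c (b₀ c) (g • y))) :=
    fun c => Module.Finite.span_of_finite ℚ (Set.finite_range _)
  rw [span_shadowCoeff_sum_single_eq_iSup_of_classes hRst hRirr hsep ι₀ hι₀eq hinj₀ hb₀,
    span_shadowCoeff_sum_single_eq_iSup_of_classes hRst hRirr hsep ι₁ hι₁eq hinj₁ hb₁,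
    finrank_iSup_inf_iSup_eq_sum_of_iSupIndep (iSupIndep_container_of_classes hRst hRirr hsep)
      (fun c => span_shadowCoeff_le_container_of_map (ι₀ c) (hι₀eq c) (hb₀ c))
      (fun c => span_shadowCoeff_le_container_of_map (ι₁ c) (hι₁eq c) (hb₁ c))]
  refine Finset.sum_congr rfl fun c _ => ?_
  by_cases h1 : b₁ c = 0
  · -- class absent from the second slot
    rw [if_neg (fun h => h.1 h1), h1, map_zero, (span_shadowCoeff_eq_bot_iff (G := G) (0 : Y₁ → ℚ)).2 rfl, inf_bot_eq,
      finrank_bot]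
  by_cases h0 : b₀ c = 0
  · -- class absent from the first slot: `D_c·0 = 0` does not contain `b¹_c ≠ 0`
    have hnot : ¬ (b₁ c ≠ 0 ∧ b₁ c ∈ (𝒟 c).map (LinearMap.applyₗ (b₀ c))) := by
      rintro ⟨-, hmem⟩
      obtain ⟨L, -, hL⟩ := (mem_map_applyₗ_iff (𝒟 c) (b₀ c) (b₁ c)).1 hmem
      rw [h0, map_zero] at hL
      exact h1 hL.symm
    rw [if_neg hnot, h0, map_zero, (span_shadowCoeff_eq_bot_iff (G := G) (0 : Y₀ → ℚ)).2 rfl, bot_inf_eq,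
      finrank_bot]
  · -- both present: gen 72 C4's certificate
    rw [finrank_span_shadowCoeff_inf_eq_ite_single (h𝒟 c) (hRst c) (hRirr c) (ι₀ c) (ι₁ c) (hι₀eq c) (hι₁eq c)
      (hinj₀ c) (hinj₁ c) (hb₀ c) h0 (hb₁ c) h1]
    by_cases hmem : b₁ c ∈ (𝒟 c).map (LinearMap.applyₗ (b₀ c))
    · rw [if_pos hmem, if_pos ⟨h1, hmem⟩]
    · rw [if_neg hmem, if_neg (fun h => hmem h.2)]

/-- **DOMINATION WITH ONE COMPONENT PER CLASS: `S(W′) ≤ S(W) ⟺ ∀ c, b¹_c ∈ D_c·b⁰_c`** (C6 class by class; for a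
scalar commutant `b¹_c ∈ ℚ·b⁰_c`). [cite: Lang2002, XVII §3] [cite: CurtisReiner1962, §27 (27.3)]
[cite: Gordon1999HodgeAVSurvey, §3 Theorem (proof), 7.5–7.7] -/
theorem span_shadowCoeff_le_iff_forall_mem_of_classes
    (h𝒟 : ∀ c (L : (Yc c → ℚ) →ₗ[ℚ] (Yc c → ℚ)), L ∈ 𝒟 c ↔ (∀ a ∈ Ar c, L a ∈ Ar c) ∧
      ∀ (k : G) (a : Yc c → ℚ), a ∈ Ar c → L (fun y => a (k • y)) = fun y => L a (k • y))
    (hRst : ∀ c (k : G) (a : Yc c → ℚ), a ∈ Ar c → (fun y => a (k • y)) ∈ Ar c)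
    (hRirr : ∀ c (W : Submodule ℚ (Yc c → ℚ)), W ≤ Ar c → W ≠ ⊥ →
      (∀ (k : G) (f : Yc c → ℚ), f ∈ W → (fun y => f (k • y)) ∈ W) → W = Ar c)
    (hR0 : ∀ c, Ar c ≠ ⊥)
    (hsep : ∀ c c' (L : (Yc c → ℚ) →ₗ[ℚ] (Yc c' → ℚ)), c ≠ c' → Ar c ≠ ⊥ → (∀ a ∈ Ar c, L a ∈ Ar c') →
      (∀ a ∈ Ar c, L a = 0 → a = 0) →
      (∀ (k : G) (a : Yc c → ℚ), a ∈ Ar c → L (fun y => a (k • y)) = fun y => L a (k • y)) → False)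
    (ι₀ : ∀ c, (Yc c → ℚ) →ₗ[ℚ] (Y₀ → ℚ)) (ι₁ : ∀ c, (Yc c → ℚ) →ₗ[ℚ] (Y₁ → ℚ))
    (hι₀eq : ∀ c (k : G) (a : Yc c → ℚ), a ∈ Ar c → ι₀ c (fun y => a (k • y)) = fun y => ι₀ c a (k • y))
    (hι₁eq : ∀ c (k : G) (a : Yc c → ℚ), a ∈ Ar c → ι₁ c (fun y => a (k • y)) = fun y => ι₁ c a (k • y))
    (hinj₀ : ∀ c, ∀ f ∈ Ar c, ι₀ c f = 0 → f = 0) (hinj₁ : ∀ c, ∀ f ∈ Ar c, ι₁ c f = 0 → f = 0)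
    {b₀ b₁ : ∀ c, Yc c → ℚ} (hb₀ : ∀ c, b₀ c ∈ Ar c) (hb₁ : ∀ c, b₁ c ∈ Ar c) :
    Submodule.span ℚ (Set.range fun y : Y₁ => fun g : G => (∑ c, ι₁ c (b₁ c)) (g • y)) ≤
        Submodule.span ℚ (Set.range fun y : Y₀ => fun g : G => (∑ c, ι₀ c (b₀ c)) (g • y)) ↔
      ∀ c, b₁ c ∈ (𝒟 c).map (LinearMap.applyₗ (b₀ c)) := by
  rw [span_shadowCoeff_sum_single_eq_iSup_of_classes hRst hRirr hsep ι₀ hι₀eq hinj₀ hb₀,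
    span_shadowCoeff_sum_single_eq_iSup_of_classes hRst hRirr hsep ι₁ hι₁eq hinj₁ hb₁]
  constructor
  · intro h c
    have hle := le_of_le_iSup_of_iSupIndep (iSupIndep_container_of_classes hRst hRirr hsep)
      (fun c' => span_shadowCoeff_le_container_of_map (ι₀ c') (hι₀eq c') (hb₀ c'))
      (span_shadowCoeff_le_container_of_map (ι₁ c) (hι₁eq c) (hb₁ c)) ((le_iSup _ c).trans h)
    exact (span_shadowCoeff_le_iff_mem_single (h𝒟 c) (hRst c) (hRirr c) (hR0 c) (ι₀ c) (ι₁ c) (hι₀eq c) (hι₁eq c)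
      (hinj₀ c) (hinj₁ c) (hb₀ c) (hb₁ c)).1 hle
  · intro h
    exact iSup_mono fun c => (span_shadowCoeff_le_iff_mem_single (h𝒟 c) (hRst c) (hRirr c) (hR0 c) (ι₀ c) (ι₁ c)
      (hι₀eq c) (hι₁eq c) (hinj₀ c) (hinj₁ c) (hb₀ c) (hb₁ c)).2 (h c)

end Single

/-! ### §3 Type ranks: two members with one component per class -/

section Family

variable {I : Type u} {E : I → Type v} [∀ i, MulAction G (E i)] [∀ i, Fintype (E i)] [Fintype I]
  [∀ i, Nonempty (E i)]

/-- **THE DEFECT OF TWO MEMBERS ACROSS ALL ISOTYPIC CLASSES** (general components, `I = {i₀, i₁}`): `∃ m_c` with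
`dim(D_c⟨b⁰_c⟩ ∩ D_c⟨b¹_c⟩) = m_c·δ_c` and **`rank Φ₀ + rank Φ₁ = rank(Φ₀,Φ₁) + 1 + Σ_c m_c·dim A_c`** — gen 70 I11's «sum
of the class defects» with each class defect read over its commutant (gen 72 C4). [cite: Gordon1999HodgeAVSurvey, §3
Theorem, 7.5–7.7 and 9.4.3] [cite: Lang2002, XVII §3] [cite: Deligne1982HodgeCycles, I.5 (p. 53)] -/
theorem typeRank_add_typeRank_eq_add_sum_mul_of_classes {ρ : G} {Φ : ∀ i, Set (E i)}
    (h : ∀ i, IsCMTypeWith ρ (Φ i)) {i₀ i₁ : I} (hI : ∀ j, j = i₀ ∨ j = i₁) (h01 : i₀ ≠ i₁)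
    (h𝒟 : ∀ c (L : (Yc c → ℚ) →ₗ[ℚ] (Yc c → ℚ)), L ∈ 𝒟 c ↔ (∀ a ∈ Ar c, L a ∈ Ar c) ∧
      ∀ (k : G) (a : Yc c → ℚ), a ∈ Ar c → L (fun y => a (k • y)) = fun y => L a (k • y))
    (hRst : ∀ c (k : G) (a : Yc c → ℚ), a ∈ Ar c → (fun y => a (k • y)) ∈ Ar c)
    (hRirr : ∀ c (W : Submodule ℚ (Yc c → ℚ)), W ≤ Ar c → W ≠ ⊥ →
      (∀ (k : G) (f : Yc c → ℚ), f ∈ W → (fun y => f (k • y)) ∈ W) → W = Ar c)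
    (hsep : ∀ c c' (L : (Yc c → ℚ) →ₗ[ℚ] (Yc c' → ℚ)), c ≠ c' → Ar c ≠ ⊥ → (∀ a ∈ Ar c, L a ∈ Ar c') →
      (∀ a ∈ Ar c, L a = 0 → a = 0) →
      (∀ (k : G) (a : Yc c → ℚ), a ∈ Ar c → L (fun y => a (k • y)) = fun y => L a (k • y)) → False)
    {JJ : I → C → Type uJ} [∀ i c, Fintype (JJ i c)] (ι : ∀ i c, JJ i c → ((Yc c → ℚ) →ₗ[ℚ] (E i → ℚ)))
    (hιeq : ∀ i c (j : JJ i c) (k : G) (a : Yc c → ℚ), a ∈ Ar c →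
      ι i c j (fun y => a (k • y)) = fun y => ι i c j a (k • y))
    (hind : ∀ i c (f : JJ i c → (Yc c → ℚ)), (∀ j, f j ∈ Ar c) → ∑ j, ι i c j (f j) = 0 → ∀ j, f j = 0)
    {b : ∀ i c, JJ i c → (Yc c → ℚ)} (hb : ∀ i c j, b i c j ∈ Ar c)
    (hu : ∀ i, antiVec (Φ i) (1 : G) = ∑ c, ∑ j, ι i c j (b i c j))
    {a₀ : ∀ c, Yc c → ℚ} (ha₀ : ∀ c, a₀ c ∈ Ar c) (h0 : ∀ c, a₀ c ≠ 0) :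
    ∃ m : C → ℕ,
      (∀ c, Module.finrank ℚ ↥((⨆ j, (𝒟 c).map (LinearMap.applyₗ (b i₀ c j))) ⊓
          ⨆ j, (𝒟 c).map (LinearMap.applyₗ (b i₁ c j))) = m c * Module.finrank ℚ ↥((𝒟 c).map (LinearMap.applyₗ (a₀ c)))) ∧
      typeRank G (Φ i₀) + typeRank G (Φ i₁) = typeRank G (sigmaType Φ) + 1 + ∑ c, m c * Module.finrank ℚ (Ar c) := by
  obtain ⟨m, hD, hS⟩ := exists_finrank_span_shadowCoeff_inf_eq_sum_mul_of_classes h𝒟 hRst hRirr hsep (ι i₀) (ι i₁)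
    (hιeq i₀) (hιeq i₁) (hind i₀) (hind i₁) (hb i₀) (hb i₁) ha₀ h0
  refine ⟨m, hD, ?_⟩
  rw [typeRank_add_typeRank_eq_of_pair h hI h01, span_coeff_eq_span_shadowCoeff_of_eq Φ i₀ (hu i₀),
    span_coeff_eq_span_shadowCoeff_of_eq Φ i₁ (hu i₁), hS]

/-- **THE MULTI-CLASS CERTIFICATE FOR A PAIR OF CM TYPES** (`I = {i₀, i₁}`, `u_i = Σ_c ι^i_c(b^i_c)`): **`rank Φ₀ + rank Φ₁
= rank(Φ₀,Φ₁) + 1 + Σ_c (dim A_c if b¹_c ≠ 0 ∧ b¹_c ∈ D_c·b⁰_c, else 0)`** — `dim Hg(A₀) + dim Hg(A₁) − dim Hg(A₀ × A₁)` is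
the total dimension of the classes whose two components lie on one D-line. [cite: Gordon1999HodgeAVSurvey, §3 Theorem,
7.5–7.7 and 9.4.3] [cite: CurtisReiner1962, §27 (27.3)] [cite: Deligne1982HodgeCycles, I.5 (p. 53)] -/
theorem typeRank_add_typeRank_eq_add_sum_ite_of_classes {ρ : G} {Φ : ∀ i, Set (E i)}
    (h : ∀ i, IsCMTypeWith ρ (Φ i)) {i₀ i₁ : I} (hI : ∀ j, j = i₀ ∨ j = i₁) (h01 : i₀ ≠ i₁)
    (h𝒟 : ∀ c (L : (Yc c → ℚ) →ₗ[ℚ] (Yc c → ℚ)), L ∈ 𝒟 c ↔ (∀ a ∈ Ar c, L a ∈ Ar c) ∧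
      ∀ (k : G) (a : Yc c → ℚ), a ∈ Ar c → L (fun y => a (k • y)) = fun y => L a (k • y))
    (hRst : ∀ c (k : G) (a : Yc c → ℚ), a ∈ Ar c → (fun y => a (k • y)) ∈ Ar c)
    (hRirr : ∀ c (W : Submodule ℚ (Yc c → ℚ)), W ≤ Ar c → W ≠ ⊥ →
      (∀ (k : G) (f : Yc c → ℚ), f ∈ W → (fun y => f (k • y)) ∈ W) → W = Ar c)
    (hsep : ∀ c c' (L : (Yc c → ℚ) →ₗ[ℚ] (Yc c' → ℚ)), c ≠ c' → Ar c ≠ ⊥ → (∀ a ∈ Ar c, L a ∈ Ar c') →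
      (∀ a ∈ Ar c, L a = 0 → a = 0) →
      (∀ (k : G) (a : Yc c → ℚ), a ∈ Ar c → L (fun y => a (k • y)) = fun y => L a (k • y)) → False)
    (ι : ∀ i c, (Yc c → ℚ) →ₗ[ℚ] (E i → ℚ))
    (hιeq : ∀ i c (k : G) (a : Yc c → ℚ), a ∈ Ar c → ι i c (fun y => a (k • y)) = fun y => ι i c a (k • y))
    (hinj : ∀ i c, ∀ f ∈ Ar c, ι i c f = 0 → f = 0)
    {b : I → ∀ c, Yc c → ℚ} (hb : ∀ i c, b i c ∈ Ar c) (hu : ∀ i, antiVec (Φ i) (1 : G) = ∑ c, ι i c (b i c)) :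
    typeRank G (Φ i₀) + typeRank G (Φ i₁) = typeRank G (sigmaType Φ) + 1 +
      ∑ c, if b i₁ c ≠ 0 ∧ b i₁ c ∈ (𝒟 c).map (LinearMap.applyₗ (b i₀ c)) then Module.finrank ℚ (Ar c) else 0 := by
  rw [typeRank_add_typeRank_eq_of_pair h hI h01, span_coeff_eq_span_shadowCoeff_of_eq Φ i₀ (hu i₀),
    span_coeff_eq_span_shadowCoeff_of_eq Φ i₁ (hu i₁),
    finrank_span_shadowCoeff_inf_eq_sum_ite_of_classes h𝒟 hRst hRirr hsep (ι i₀) (ι i₁) (hιeq i₀) (hιeq i₁) (hinj i₀)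
      (hinj i₁) (hb i₀) (hb i₁)]

omit [Fintype I] in
/-- **PAIR DOMINATION WITH ONE COMPONENT PER CLASS: `rank(Φ₀,Φ₁) = rank Φ₀ ⟺ ∀ c, b¹_c ∈ D_c·b⁰_c`** (`I = {i₀, i₁}`).
[cite: Deligne1982HodgeCycles, I.5 (p. 53)] [cite: Gordon1999HodgeAVSurvey, §3 Theorem (proof), 7.5–7.7] -/
theorem typeRank_pair_eq_typeRank_iff_forall_mem_of_classes [Fintype I] {ρ : G} {Φ : ∀ i, Set (E i)}
    (h : ∀ i, IsCMTypeWith ρ (Φ i)) {i₀ i₁ : I} (hI : ∀ j, j = i₀ ∨ j = i₁)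
    (h𝒟 : ∀ c (L : (Yc c → ℚ) →ₗ[ℚ] (Yc c → ℚ)), L ∈ 𝒟 c ↔ (∀ a ∈ Ar c, L a ∈ Ar c) ∧
      ∀ (k : G) (a : Yc c → ℚ), a ∈ Ar c → L (fun y => a (k • y)) = fun y => L a (k • y))
    (hRst : ∀ c (k : G) (a : Yc c → ℚ), a ∈ Ar c → (fun y => a (k • y)) ∈ Ar c)
    (hRirr : ∀ c (W : Submodule ℚ (Yc c → ℚ)), W ≤ Ar c → W ≠ ⊥ →
      (∀ (k : G) (f : Yc c → ℚ), f ∈ W → (fun y => f (k • y)) ∈ W) → W = Ar c)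
    (hR0 : ∀ c, Ar c ≠ ⊥)
    (hsep : ∀ c c' (L : (Yc c → ℚ) →ₗ[ℚ] (Yc c' → ℚ)), c ≠ c' → Ar c ≠ ⊥ → (∀ a ∈ Ar c, L a ∈ Ar c') →
      (∀ a ∈ Ar c, L a = 0 → a = 0) →
      (∀ (k : G) (a : Yc c → ℚ), a ∈ Ar c → L (fun y => a (k • y)) = fun y => L a (k • y)) → False)
    (ι : ∀ i c, (Yc c → ℚ) →ₗ[ℚ] (E i → ℚ))
    (hιeq : ∀ i c (k : G) (a : Yc c → ℚ), a ∈ Ar c → ι i c (fun y => a (k • y)) = fun y => ι i c a (k • y))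
    (hinj : ∀ i c, ∀ f ∈ Ar c, ι i c f = 0 → f = 0)
    {b : I → ∀ c, Yc c → ℚ} (hb : ∀ i c, b i c ∈ Ar c) (hu : ∀ i, antiVec (Φ i) (1 : G) = ∑ c, ι i c (b i c)) :
    typeRank G (sigmaType Φ) = typeRank G (Φ i₀) ↔ ∀ c, b i₁ c ∈ (𝒟 c).map (LinearMap.applyₗ (b i₀ c)) := by
  rw [typeRank_sigmaType_eq_typeRank_iff_span_coeff_le_of_pair h hI, span_coeff_eq_span_shadowCoeff_of_eq Φ i₀ (hu i₀),
    span_coeff_eq_span_shadowCoeff_of_eq Φ i₁ (hu i₁)]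
  exact span_shadowCoeff_le_iff_forall_mem_of_classes h𝒟 hRst hRirr hR0 hsep (ι i₀) (ι i₁) (hιeq i₀) (hιeq i₁) (hinj i₀)
    (hinj i₁) (hb i₀) (hb i₁)

end Family

end Summit.HodgeConjecture.CorCM.IrrOdd

/-! ### CM dress -/

namespace Summit.HodgeConjecture.CorCM

open CategoryTheory CategoryTheory.Limits NumberField Module IntermediateField
open Literature.NumberTheory.ComplexMultiplication
open Literature.AlgebraicGeometry.Motives (AbelianVariety CMType)
open Literature.AlgebraicGeometry.Motives.AbelianVariety
open Literature.AlgebraicGeometry.HodgeTheory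
open Literature.AlgebraicGeometry.ComplexMultiplication (IsCMTypeRealisation)
open Literature.AlgebraicGeometry.Pohlmann1968

variable {I : Type} [Fintype I] {K : I → Type} [∀ i, Field (K i)] [∀ i, NumberField (K i)] [∀ i, IsCMField (K i)]
  {C : Type} [Fintype C] {Yc : C → Type} [∀ c, MulAction (ℂ ≃+* ℂ) (Yc c)] [∀ c, Fintype (Yc c)]
  {Ar : ∀ c, Submodule ℚ (Yc c → ℚ)} {𝒟 : ∀ c, Submodule ℚ ((Yc c → ℚ) →ₗ[ℚ] (Yc c → ℚ))}

/-- **THE MULTI-CLASS CERTIFICATE (CM fields): `dim MT(A₀) + dim MT(A₁) = dim MT(A₀ × A₁) + 1 + Σ_c (dim A_c if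
b¹_c ≠ 0 ∧ b¹_c ∈ D_c·b⁰_c, else 0)`** for `I = {i₀, i₁}` and type vectors with one component per class.
[cite: Gordon1999HodgeAVSurvey, §3 Theorem, 7.5–7.7 and 9.4.3] [cite: CurtisReiner1962, §27 (27.3)] -/
theorem cmTypeRank_add_cmTypeRank_eq_add_sum_ite_of_classes (Φ : ∀ i, CMType (K i)) {i₀ i₁ : I}
    (hI : ∀ j, j = i₀ ∨ j = i₁) (h01 : i₀ ≠ i₁)
    (h𝒟 : ∀ c (L : (Yc c → ℚ) →ₗ[ℚ] (Yc c → ℚ)), L ∈ 𝒟 c ↔ (∀ a ∈ Ar c, L a ∈ Ar c) ∧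
      ∀ (k : ℂ ≃+* ℂ) (a : Yc c → ℚ), a ∈ Ar c → L (fun y => a (k • y)) = fun y => L a (k • y))
    (hRst : ∀ c (k : ℂ ≃+* ℂ) (a : Yc c → ℚ), a ∈ Ar c → (fun y => a (k • y)) ∈ Ar c)
    (hRirr : ∀ c (W : Submodule ℚ (Yc c → ℚ)), W ≤ Ar c → W ≠ ⊥ →
      (∀ (k : ℂ ≃+* ℂ) (f : Yc c → ℚ), f ∈ W → (fun y => f (k • y)) ∈ W) → W = Ar c)
    (hsep : ∀ c c' (L : (Yc c → ℚ) →ₗ[ℚ] (Yc c' → ℚ)), c ≠ c' → Ar c ≠ ⊥ → (∀ a ∈ Ar c, L a ∈ Ar c') →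
      (∀ a ∈ Ar c, L a = 0 → a = 0) →
      (∀ (k : ℂ ≃+* ℂ) (a : Yc c → ℚ), a ∈ Ar c → L (fun y => a (k • y)) = fun y => L a (k • y)) → False)
    (ι : ∀ i c, (Yc c → ℚ) →ₗ[ℚ] ((K i →+* ℂ) → ℚ))
    (hιeq : ∀ i c (k : ℂ ≃+* ℂ) (a : Yc c → ℚ), a ∈ Ar c → ι i c (fun y => a (k • y)) = fun y => ι i c a (k • y))
    (hinj : ∀ i c, ∀ f ∈ Ar c, ι i c f = 0 → f = 0)
    {b : I → ∀ c, Yc c → ℚ} (hb : ∀ i c, b i c ∈ Ar c)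
    (hu : ∀ i, antiVec (Φ i).1 (1 : ℂ ≃+* ℂ) = ∑ c, ι i c (b i c)) :
    cmTypeRank (Φ i₀) + cmTypeRank (Φ i₁) = CMAlgebra.cmFamilyRank Φ + 1 +
      ∑ c, if b i₁ c ≠ 0 ∧ b i₁ c ∈ (𝒟 c).map (LinearMap.applyₗ (b i₀ c)) then Module.finrank ℚ (Ar c) else 0 := by
  haveI : ∀ i, Nonempty (K i →+* ℂ) := fun i => inferInstance
  exact IrrOdd.typeRank_add_typeRank_eq_add_sum_ite_of_classes (G := ℂ ≃+* ℂ) (E := fun i => K i →+* ℂ)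
    (Φ := fun i => (Φ i).1) (fun i => isCMTypeWith_conj (Φ i)) hI h01 h𝒟 hRst hRirr hsep ι hιeq hinj hb hu

/-- **PAIR DOMINATION WITH ONE COMPONENT PER CLASS (CM fields): `dim MT(A₀ × A₁) = dim MT(A₀) ⟺ ∀ c, b¹_c ∈ D_c·b⁰_c`**.
[cite: Deligne1982HodgeCycles, I.5 (p. 53)] [cite: Gordon1999HodgeAVSurvey, §3 Theorem (proof), 7.5–7.7 and 9.4.3]
[cite: Lang2002, XVII §3] -/
theorem cmFamilyRank_pair_eq_cmTypeRank_iff_forall_mem_of_classes (Φ : ∀ i, CMType (K i)) {i₀ i₁ : I}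
    (hI : ∀ j, j = i₀ ∨ j = i₁)
    (h𝒟 : ∀ c (L : (Yc c → ℚ) →ₗ[ℚ] (Yc c → ℚ)), L ∈ 𝒟 c ↔ (∀ a ∈ Ar c, L a ∈ Ar c) ∧
      ∀ (k : ℂ ≃+* ℂ) (a : Yc c → ℚ), a ∈ Ar c → L (fun y => a (k • y)) = fun y => L a (k • y))
    (hRst : ∀ c (k : ℂ ≃+* ℂ) (a : Yc c → ℚ), a ∈ Ar c → (fun y => a (k • y)) ∈ Ar c)
    (hRirr : ∀ c (W : Submodule ℚ (Yc c → ℚ)), W ≤ Ar c → W ≠ ⊥ →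
      (∀ (k : ℂ ≃+* ℂ) (f : Yc c → ℚ), f ∈ W → (fun y => f (k • y)) ∈ W) → W = Ar c)
    (hR0 : ∀ c, Ar c ≠ ⊥)
    (hsep : ∀ c c' (L : (Yc c → ℚ) →ₗ[ℚ] (Yc c' → ℚ)), c ≠ c' → Ar c ≠ ⊥ → (∀ a ∈ Ar c, L a ∈ Ar c') →
      (∀ a ∈ Ar c, L a = 0 → a = 0) →
      (∀ (k : ℂ ≃+* ℂ) (a : Yc c → ℚ), a ∈ Ar c → L (fun y => a (k • y)) = fun y => L a (k • y)) → False)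
    (ι : ∀ i c, (Yc c → ℚ) →ₗ[ℚ] ((K i →+* ℂ) → ℚ))
    (hιeq : ∀ i c (k : ℂ ≃+* ℂ) (a : Yc c → ℚ), a ∈ Ar c → ι i c (fun y => a (k • y)) = fun y => ι i c a (k • y))
    (hinj : ∀ i c, ∀ f ∈ Ar c, ι i c f = 0 → f = 0)
    {b : I → ∀ c, Yc c → ℚ} (hb : ∀ i c, b i c ∈ Ar c)
    (hu : ∀ i, antiVec (Φ i).1 (1 : ℂ ≃+* ℂ) = ∑ c, ι i c (b i c)) :
    CMAlgebra.cmFamilyRank Φ = cmTypeRank (Φ i₀) ↔ ∀ c, b i₁ c ∈ (𝒟 c).map (LinearMap.applyₗ (b i₀ c)) := by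
  haveI : ∀ i, Nonempty (K i →+* ℂ) := fun i => inferInstance
  exact IrrOdd.typeRank_pair_eq_typeRank_iff_forall_mem_of_classes (G := ℂ ≃+* ℂ) (E := fun i => K i →+* ℂ)
    (Φ := fun i => (Φ i).1) (fun i => isCMTypeWith_conj (Φ i)) hI h𝒟 hRst hRirr hR0 hsep ι hιeq hinj hb hu

end Summit.HodgeConjecture.CorCM

end
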